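import Summits.CriticalPhenomena.CardyFormulaZ2.Theorems.CardyIKTransportIKLinearTransportStubCutMarkovLocalSweep

/-!
# Stub `stub_CutMarkovLocal` (Loc) — part E₁: TWO CUT-MARKOV VERSIONS agree almost everywhere, also along an
# exact sweep, and drive the same rows above a cut

Support file (`--supports stmt-CriticalPhenomena-5076`, registered sub-goal `sweep_versions_null`).

The registered (Loc) quantifies over EVERY cut-Markov version `k` of the conditional middle-row law
(`CutMarkovKernel S i k`), while a `2r`-local approximant can only be built for a version that is two-sided local in
the environment (`ReadsEnv`, `…StubCutMarkovLocalSweep.lean`, `…StubCutMarkovLocal.lean`). The gap is closed in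
`…StubCutMarkovLocalTransfer.lean` from the three facts of this file:

* `crk_versions_ae` — two versions agree almost everywhere along the row statistic: both `k ∘ rowStat` and
  `k₂ ∘ rowStat` are densities of the same measures (field `law`), `ae_eq_of_forall_setLIntegral_eq_of_sigmaFinite`;
* `crk_sweep_versions_null` (registered as `sweep_versions_null`) — along a sweep started from the TRUE configuration,
  the argument at which row `a+j` evaluates the kernel has, by EXACTNESS of the heat bath
  (`ps2_exact_sweep_of_exact_row` with the kernel identity `crk_kernel_identity`) and shift invariance, the law of
  `rowStat`, so the two kernels agree there almost surely;
* `crk_sweep_agree_versions` — above a cut row, if the two kernels agree at the arguments of the `k`-sweep, the two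
  heat baths from the same start produce the same rows (the field `reads` absorbs the rows below the cut, the
  sampled row reads the kernel value only, `crkQ_congr'`).
-/

noncomputable section

namespace Summit.CriticalPhenomena.CardyFormulaZ2.Theorems.IKLinearTransport.PinnedDiagramExchange

open scoped Classical MeasureTheory ENNReal symmDiff
open Set MeasureTheory
open Literature.Probability.Percolation Literature.Probability.LatticeModels

/-! ## Two versions above a cut row: the deterministic step -/

section Det

variable (S : Set ℤ) (i : ℤ) (k k₂ : (Obs × Set (Site 2 × Site 2)) × Obs → Bool × Bool × Bool → ℝ)

/-- The sampled row reads (kernel, statistic) only through the weight vector. [folklore] -/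
theorem crkQ_congr' {t t' : (Obs × Set (Site 2 × Site 2)) × Obs} (h : k t = k₂ t') (r : ℝ) :
    crkQ k (t, r) = crkQ k₂ (t', r) := by
  simp only [crkQ, crkWeights, h]

/-- `MidAgree` is symmetric. [folklore] -/
theorem midAgree_symm {i lo hi : ℤ} {z z' : Obs} (h : MidAgree i lo hi z z') : MidAgree i lo hi z' z :=
  fun w a b => ⟨fun c => ((h w a b).1 c).symm, fun c => ((h w a b).2 c).symm⟩

/-- Writing the same middle bits at row `y'` on two configurations agreeing on the middle rows `[lo, y')`. [folklore] -/
theorem midAgree_setMid (lo y' : ℤ) (A A' : Obs) (B : Prop × Prop × Prop) (hA : MidAgree i lo y' A A') :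
    MidAgree i lo (y' + 1) (setMid i y' A B) (setMid i y' A' B) := by
  -- adapted from `crk_step_agree` (…StubCoalescingRowKernelReduction.lean)
  intro w hw1 hw2
  by_cases hwy : w 1 = y'
  · refine ⟨fun hw0 => ?_, fun hw0 => ?_⟩
    · have : w = ![i + 1, y'] := by rw [ps2_eq_vec2 w, hw0, hwy]
      subst this
      rw [(rowBits_setMid i y' A B).1, (rowBits_setMid i y' A' B).1]
    · rcases hw0 with hw0 | hw0
      · have : w = ![i, y'] := by rw [ps2_eq_vec2 w, hw0, hwy]
        subst this
        rw [(rowBits_setMid i y' A B).2.1, (rowBits_setMid i y' A' B).2.1]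
      · have : w = ![i + 1, y'] := by rw [ps2_eq_vec2 w, hw0, hwy]
        subst this
        rw [(rowBits_setMid i y' A B).2.2, (rowBits_setMid i y' A' B).2.2]
  · have hw2' : w 1 < y' := by omega
    have hne1 : w ≠ ![i + 1, y'] := fun h => hwy (by rw [h]; simp)
    have hne2 : w ≠ ![i, y'] := fun h => hwy (by rw [h]; simp)
    refine ⟨fun hw0 => ?_, fun hw0 => ?_⟩
    · rw [(setMid_off i y' A B).1 w hne1, (setMid_off i y' A' B).1 w hne1]
      exact (hA w hw1 hw2').1 hw0
    · rw [(setMid_off i y' A B).2 w hne2 hne1, (setMid_off i y' A' B).2 w hne2 hne1]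
      exact (hA w hw1 hw2').2 hw0

/-- Above a cut row, a cut-Markov kernel gives the same value on two pasts agreeing above the cut. [folklore] -/
theorem crk_reads_congr (hk : CutMarkovKernel S i k) (c y' : ℤ) (hcy : c + 1 ≤ y') (p : Obs × Set (Site 2 × Site 2))
    (hcut : IsCut i c p) (A A' : Obs) (hA : MidAgree i (c + 1) y' A A') :
    k (pshift (-y') p, pastMid i 0 (vshift (-y') A)) = k (pshift (-y') p, pastMid i 0 (vshift (-y') A')) := by
  -- adapted from `crk_step_agree` (…StubCoalescingRowKernelReduction.lean)
  refine hk.reads (pshift (-y') p) _ _ (c - y') (by omega) ?_ fun w hw => ?_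
  · rw [isCut_pshift, show c - y' - -y' = c by ring]; exact hcut
  · have e := ps2_sub_vec_apply w (-y')
    have hA' := hA (w - ![0, -y']) (by rw [e.2]; omega)
    simp only [pastMid, vshift, mem_setOf_eq, Set.mem_preimage]
    constructor
    · constructor
      · rintro ⟨h1, h2, h3⟩; exact ⟨((hA' (by rw [e.2]; omega)).1 (by rw [e.1]; exact h2)).1 h1, h2, h3⟩
      · rintro ⟨h1, h2, h3⟩; exact ⟨((hA' (by rw [e.2]; omega)).1 (by rw [e.1]; exact h2)).2 h1, h2, h3⟩
    · constructor
      · rintro ⟨h1, h2, h3⟩; exact ⟨((hA' (by rw [e.2]; omega)).2 (by rw [e.1]; exact h2)).1 h1, h2, h3⟩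
      · rintro ⟨h1, h2, h3⟩; exact ⟨((hA' (by rw [e.2]; omega)).2 (by rw [e.1]; exact h2)).2 h1, h2, h3⟩

/-- TWO VERSIONS ABOVE A CUT ROW: if, at every row above the cut, the two kernels agree at the argument of the
`k`-sweep, the sweeps of the two heat baths from the same start agree on the middle rows above the cut. [folklore] -/
theorem crk_sweep_agree_versions (hk₂ : CutMarkovKernel S i k₂) (c a : ℤ) (hca : a ≤ c + 1)
    (p : Obs × Set (Site 2 × Site 2)) (hcut : IsCut i c p) (u : Rnd) (z : Obs) :
    ∀ n : ℕ, (∀ j : ℕ, j < n → c + 1 ≤ a + j →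
      k (pshift (-(a + j)) p, pastMid i 0 (vshift (-(a + j)) (rowSweep (rowDyn i crkU (crkG S i k)) j a p u z))) =
      k₂ (pshift (-(a + j)) p, pastMid i 0 (vshift (-(a + j)) (rowSweep (rowDyn i crkU (crkG S i k)) j a p u z)))) →
    MidAgree i (c + 1) (a + n) (rowSweep (rowDyn i crkU (crkG S i k)) n a p u z)
      (rowSweep (rowDyn i crkU (crkG S i k₂)) n a p u z)
  | 0 => fun _ w hw1 hw2 => by push_cast at hw2; omega
  | n + 1 => by
    intro hyp
    have ih := crk_sweep_agree_versions hk₂ c a hca p hcut u z n fun j hj hcj => hyp j (by omega) hcj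
    rw [crk_rowSweep_succ, crk_rowSweep_succ, show a + ((n + 1 : ℕ) : ℤ) = (a + n) + 1 by push_cast; ring]
    set A := rowSweep (rowDyn i crkU (crkG S i k)) n a p u z
    set A' := rowSweep (rowDyn i crkU (crkG S i k₂)) n a p u z
    by_cases hcn : c + 1 ≤ a + n
    · have hval := hyp n (Nat.lt_succ_self n) hcn
      have hreads := crk_reads_congr S i k₂ hk₂ c (a + n) hcn p hcut A A' ih
      have hQ := crkQ_congr' k k₂ (hval.trans hreads) (crkU ![i + 1, 0] (ushift (-(a + n)) u))
      rw [crk_rowDyn_eq, crk_rowDyn_eq, hQ]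
      exact midAgree_setMid i (c + 1) (a + n) A A' _ ih
    · intro w hw1 hw2; omega

end Det

/-! ## Two versions agree almost everywhere, also along an exact sweep -/

section AE

variable (S : Set ℤ) (i : ℤ) (k k₂ : (Obs × Set (Site 2 × Site 2)) × Obs → Bool × Bool × Bool → ℝ)

/-- The disagreement set of two measurable kernels is measurable. [folklore] -/
theorem crk_measurableSet_ne (hk : CutMarkovKernel S i k) (hk₂ : CutMarkovKernel S i k₂) :
    MeasurableSet {t : (Obs × Set (Site 2 × Site 2)) × Obs | k t ≠ k₂ t} := by
  have : {t : (Obs × Set (Site 2 × Site 2)) × Obs | k t ≠ k₂ t} = ⋃ b, {t | k t b = k₂ t b}ᶜ := by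
    ext t; simp only [mem_setOf_eq, mem_iUnion, mem_compl_iff, Function.ne_iff]
  rw [this]
  exact MeasurableSet.iUnion fun b => (measurableSet_eq_fun (hk.measurable b) (hk₂.measurable b)).compl

/-- TWO CUT-MARKOV VERSIONS AGREE ALMOST EVERYWHERE along the row statistic. [folklore] -/
theorem crk_versions_ae (hk : CutMarkovKernel S i k) (hk₂ : CutMarkovKernel S i k₂) :
    (νmix (S ∆ {i, i + 1})) {x | k (rowStat i x) ≠ k₂ (rowStat i x)} = 0 := by
  set ν' := νmix (S ∆ {i, i + 1}) with hν'
  haveI : IsProbabilityMeasure ν' := isProbabilityMeasure_nuMix _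
  set μ := ν'.map (rowStat i) with hμ
  haveI : IsProbabilityMeasure μ := Measure.isProbabilityMeasure_map (measurable_rowStat i).aemeasurable
  -- each coordinate `b`: two densities of the same measure
  have hb : ∀ b : Bool × Bool × Bool, ∀ᵐ t ∂μ, k t b = k₂ t b := by
    intro b
    have hf : Measurable fun t => ENNReal.ofReal (k t b) := (hk.measurable b).ennreal_ofReal
    have hg : Measurable fun t => ENNReal.ofReal (k₂ t b) := (hk₂.measurable b).ennreal_ofReal
    have key : ∀ s, MeasurableSet s → μ s < ∞ →
        ∫⁻ t in s, ENNReal.ofReal (k t b) ∂μ = ∫⁻ t in s, ENNReal.ofReal (k₂ t b) ∂μ := by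
      intro s hs _
      rw [hμ, setLIntegral_map hs hf (measurable_rowStat i), setLIntegral_map hs hg (measurable_rowStat i),
        ← hk.law s hs b, ← hk₂.law s hs b]
    have hae := ae_eq_of_forall_setLIntegral_eq_of_sigmaFinite hf hg key
    filter_upwards [hae] with t ht
    exact (ENNReal.ofReal_eq_ofReal_iff (hk.nonneg t b) (hk₂.nonneg t b)).1 ht
  have hall : ∀ᵐ t ∂μ, k t = k₂ t := by
    have := ae_all_iff.2 hb
    filter_upwards [this] with t ht
    exact funext ht
  have hback : ∀ᵐ x ∂ν', k (rowStat i x) = k₂ (rowStat i x) := ae_of_ae_map (measurable_rowStat i).aemeasurable hall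
  exact ae_iff.1 hback

/-- EXACTNESS of the sweeps of the reduction's heat bath (from `ps2_exact_sweep_of_exact_row` and the kernel
identity). [folklore] -/
theorem crk_sweep_exact (hk : CutMarkovKernel S i k) (n : ℕ) (a : ℤ) (D : Set ((Obs × Set (Site 2 × Site 2)) × Obs))
    (hDm : MeasurableSet D)
    (hD : ∀ (p : Obs × Set (Site 2 × Site 2)) (z z' : Obs), (∀ w : Site 2, w 1 < a + n →
      (w ∈ z.1 ↔ w ∈ z'.1) ∧ (w ∈ z.2 ↔ w ∈ z'.2)) → ((p, z) ∈ D ↔ (p, z') ∈ D)) :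
    ((νmix (S ∆ {i, i + 1})).prod β)
        {xu | (pinnedStat i xu.1, rowSweep (rowDyn i crkU (crkG S i k)) n a (pinnedStat i xu.1) xu.2 xu.1) ∈ D} =
      (νmix (S ∆ {i, i + 1})) {x | (pinnedStat i x, x) ∈ D} :=
  (ps2_exact_sweep_of_exact_row S i (rowDyn i crkU (crkG S i k)) (rowSweep (rowDyn i crkU (crkG S i k)))
    (fun _ _ _ _ _ => rfl) (rowDyn_measurable i crkU _ crkU_spec.1 (measurable_crkG S i k hk)) (rowDyn_writes i crkU _)
    (rowDyn_rd i crkU _ crkU_spec.2.1 crkU_spec.2.2.1) (rowDyn_past i crkU _)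
    (rowDyn_exact i crkU _ S crkU_spec.1 (measurable_crkG S i k hk) (crk_kernel_identity S i k hk))).2 n a D hDm hD

/-- ALONG AN EXACT SWEEP FROM THE TRUE CONFIGURATION THE TWO VERSIONS AGREE ALMOST SURELY at the argument of
every row. [folklore] -/
theorem crk_sweep_versions_null (hk : CutMarkovKernel S i k) (hk₂ : CutMarkovKernel S i k₂) (a : ℤ) (j : ℕ) :
    ((νmix (S ∆ {i, i + 1})).prod β) {xu | k (pshift (-(a + j)) (pinnedStat i xu.1),
        pastMid i 0 (vshift (-(a + j)) (rowSweep (rowDyn i crkU (crkG S i k)) j a (pinnedStat i xu.1) xu.2 xu.1))) ≠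
      k₂ (pshift (-(a + j)) (pinnedStat i xu.1),
        pastMid i 0 (vshift (-(a + j)) (rowSweep (rowDyn i crkU (crkG S i k)) j a (pinnedStat i xu.1) xu.2 xu.1)))} = 0 := by
  set ν' := νmix (S ∆ {i, i + 1}) with hν'
  haveI : IsProbabilityMeasure ν' := isProbabilityMeasure_nuMix _
  set y' : ℤ := a + j with hy'
  set F : (Obs × Set (Site 2 × Site 2)) × Obs → (Obs × Set (Site 2 × Site 2)) × Obs :=
    fun q => (pshift (-y') q.1, pastMid i 0 (vshift (-y') q.2)) with hF
  have hFm : Measurable F :=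
    ((measurable_pshift _).comp measurable_fst).prodMk ((measurable_pastMid i 0).comp ((measurable_vshift _).comp measurable_snd))
  set D : Set ((Obs × Set (Site 2 × Site 2)) × Obs) := F ⁻¹' {t | k t ≠ k₂ t} with hD
  have hDm : MeasurableSet D := hFm (crk_measurableSet_ne S i k k₂ hk hk₂)
  have hDread : ∀ (p : Obs × Set (Site 2 × Site 2)) (z z' : Obs), (∀ w : Site 2, w 1 < a + j →
      (w ∈ z.1 ↔ w ∈ z'.1) ∧ (w ∈ z.2 ↔ w ∈ z'.2)) → ((p, z) ∈ D ↔ (p, z') ∈ D) := by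
    intro p z z' h
    have hp : pastMid i 0 (vshift (-y') z) = pastMid i 0 (vshift (-y') z') := by
      refine pastMid_congr i 0 _ _ fun w hw => ?_
      have e := ps2_sub_vec_apply w (-y')
      exact h (w - ![0, -y']) (by rw [e.2]; omega)
    simp only [hD, hF, mem_preimage, mem_setOf_eq, hp]
  have h1 := crk_sweep_exact S i k hk j a D hDm hDread
  have h2 : {x : Obs | (pinnedStat i x, x) ∈ D} = (vshift (-y')) ⁻¹' {x | k (rowStat i x) ≠ k₂ (rowStat i x)} := by
    ext x
    simp only [hD, hF, mem_preimage, mem_setOf_eq, rowStat, pinnedStat_vshift']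
  have hm : MeasurableSet {x : Obs | k (rowStat i x) ≠ k₂ (rowStat i x)} :=
    (measurable_rowStat i) (crk_measurableSet_ne S i k k₂ hk hk₂)
  have h3 : ν' {x : Obs | (pinnedStat i x, x) ∈ D} = 0 := by
    rw [h2, ← Measure.map_apply (measurable_vshift _) hm, nuMix_map_vshift]
    exact crk_versions_ae S i k k₂ hk hk₂
  exact h1.trans h3

end AE

/-! ## The registered form -/

/-- ALONG AN EXACT SWEEP THE TWO VERSIONS AGREE ALMOST SURELY (registered sub-goal `sweep_versions_null`): for two
cut-Markov versions `k, k₂` of the conditional middle-row law, the event that they differ at the argument at which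
row `a+j` of the `k`-heat-bath sweep from the true configuration evaluates its kernel is `νmix (S ∆ {i,i+1}) ⊗ β`-null.
[folklore] -/
theorem sweep_versions_null : ∀ (S : Set ℤ) (i : ℤ) (k k₂ : (Obs × Set (Site 2 × Site 2)) × Obs → Bool × Bool × Bool → ℝ),
    CutMarkovKernel S i k → CutMarkovKernel S i k₂ → ∀ (a : ℤ) (j : ℕ),
    ((νmix (S ∆ {i, i + 1})).prod β) {xu | k (pshift (-(a + j)) (pinnedStat i xu.1),
        pastMid i 0 (vshift (-(a + j)) (rowSweep (rowDyn i crkU (crkG S i k)) j a (pinnedStat i xu.1) xu.2 xu.1))) ≠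
      k₂ (pshift (-(a + j)) (pinnedStat i xu.1),
        pastMid i 0 (vshift (-(a + j)) (rowSweep (rowDyn i crkU (crkG S i k)) j a (pinnedStat i xu.1) xu.2 xu.1)))} = 0 :=
  fun S i k k₂ hk hk₂ a j => crk_sweep_versions_null S i k k₂ hk hk₂ a j

end Summit.CriticalPhenomena.CardyFormulaZ2.Theorems.IKLinearTransport.PinnedDiagramExchange
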